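import Summits.FinalStateConjecture.FinalStateConjecture.Theorems.PhotonSphereChannelsDarkFutureDefs
import Summits.FinalStateConjecture.FinalStateConjecture.Theorems.PhotonSphereChannelsChannelsResolveTameDevelopmentsRGlobalCloseness
import Literature.Geometry.Lorentzian.SpacetimeLocalConvergenceRestrict
import HarnessLib

/-!
# Crux `ChannelsResolveTameDevelopmentsR` (K2R-T2, stmt-FinalStateConjecture-17430), line `dark-future-exactness`,
# stub P′ `stub_hullNearKerrIsSlabClose` — the exterior-window API, and the two FREEDOMS of a horizon-hull element:
# TRIMMING the carrier and RE-CHOOSING the end structure (clock) keep hull membership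

Over the landed vocabulary `Theorems/PhotonSphereChannelsDarkFutureDefs.lean` (`exteriorWindow`, `IsExteriorWindowClose`,
`IsSlabClose … ρ …`, `IsHorizonHullElement(Along)`; Reshape 1 of lead c7) and `…TameHullDefs` / `…KerrDevDefs`. Sorry-free,
no definitions, no named facts.

* §1 `exteriorWindow_eq_empty`, `isExteriorWindowClose_of_le` — for `W ≤ r₊ + η` the exterior window is EMPTY and
  `IsExteriorWindowClose 𝓢 E M a W η δ` holds for EVERY end and every real `δ` (the producer P′ must pick `W > r₊ + η`);
  `isExteriorWindowClose_of_isKerrDoc` — an end whose d.o.c. is an exact Kerr `(M, a)` exterior is `(W, η, δ)`-window-close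
  for ALL `W, η, δ` (anti-vacuity of P′'s hypothesis on the Kerr locus); `IsExteriorWindowClose.mono` (monotone in `(W, η, δ)`).
* §2 `IsHorizonHullElementAlong.trim`, `IsHorizonHullElement.trim` — hull membership passes to every connected open
  sub-spacetime `𝓢|_W ∋ p` carrying a transported end (the tree's `SubconvergesLocallyTo` has NO covering clause:
  `Spacetime.SubconvergesLocallyTo.restrict'`). Transport hypotheses stated as data: an end datum `E'` of `𝓢|_W` in the
  class, silent, with `p` on its horizon.
* §3 `IsHorizonHullElementAlong.of_sameCarrier`, `IsHorizonHullElement.of_sameCarrier` — hull membership is a property of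
  the POINTED CARRIER `(𝓢, p)` alone: ANY end datum `E'` of the same `𝓢` that is in some class `(Λ', r₀')`, silent, with `p`
  on its horizon, is again a horizon-hull element along the same `γ ∘ s` — in particular every RE-CLOCKING
  `⟨E.M, E.R, E.C, E.far, clock'⟩` (same far chart, new clock), whose d.o.c., horizon, far deviation, non-radiation and
  exterior windows are those of `E` DEFINITIONALLY (`doc_reclock`, `horizon_reclock`, `isNonRadiating_reclock_iff`,
  `isExteriorWindowClose_reclock_iff`, `isKerrDoc_doc_reclock_iff`). This is the formal core of the wave-2 finding
  (stub-worker P′, `work/stubs/w2_stub_hullNearKerrIsSlabClose.md`): the COVERAGE clause of `IsSlabClose`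
  (`{q ∈ E.doc | |E.clock q − c| < 1} ⊆ Ψ {r > r₊, |x⁰| < 2}`) is phrased in the end's OWN clock with absolute widths, while
  `IsTameClass` admits stationary radial clocks `x⁰ + F(r)` with `|F'| ≤ 2/3` (lapse window `N² ∈ [1/2, 3/2]` forced by the
  `C⁰ ≤ 1/2` clause of the clock-adapted balls), hence drifts `|F(r₊) − F(R)|` up to `≈ (2/3)(Λ 0 − r₊) > 2`, under which no
  `ε`-isometric Kerr–Schild slab of `x⁰`-width `4` covers a unit clock-epoch (the tree's own Painlevé–Gullstrand profile
  `F' = f_PG` on `[2M, R_a]` drifts by `4M[ln 2 − 1 + 1/s + ln (s/(1+s))]`, `s = √(2M/R_a)`: `2.04 M` at `R_a = 7M`,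
  `3.02 M` at `10 M`).
* §4 `not_hullNearKerrIsSlabClose_of_witness` — the registered P′ (depth `ρ` announced; inlined VERBATIM as the negated
  formula) is refuted by any witness defeating every depth: for each `ρ ∈ (r₋, r₊)` some `(k, β < 2, ε > 0)` such that for all
  window sizes a horizon-hull element along `γ` is window-close but slab-close from `ρ` to NO `ε`-near Kerr at any epoch;
  `witness_of_sameCarrier` — such a witness is ONE horizon-hull element together with siblings ON THE SAME CARRIER (§3) that
  are window-close at every scale (e.g. exact Kerr d.o.c., §1) and never slab-close. No development with `DevHyp` and a
  nonempty horizon is certified in the tree, so this stays a conditional refutation ("P′ is false wherever the line is not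
  vacuous"), exactly as for the wave-1 trimming witness.
* §5 `stub_hullNearKerrIsSlabClose_closedPieces` — the registered bundle (sub-goal of stmt-FinalStateConjecture-17430).

References: P. Petersen, *Riemannian Geometry*, 2nd ed., Ch. 10 §3.2 [Petersen2006]; M. Dafermos, J. Luk, arXiv:1710.01722,
§1.2.1 and Conjecture 1 [DafermosLuk2017]; K. Martel, E. Poisson, Am. J. Phys. 69 (2001) 476, §II [MartelPoisson2001];
S. Klainerman, J. Szeftel, PAMQ 19 (2023), §3.1.1 [KlainermanSzeftel2023]; M. T. Anderson, arXiv:gr-qc/0208079, Def. 1.1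
[Anderson2004].
-/

noncomputable section

-- the operator-norm instance on `E4 →L[ℝ] E4 →L[ℝ] ℝ` needs one more level of pending
-- instance problems than the default (as in `PhotonSphereChannelsDarkFutureDefs.lean`)
set_option maxSynthPendingDepth 3
-- every `Summit.FinalStateConjecture.FinalStateConjecture.…` name repeats the summit = sub-problem segment (D-0017 layout)
set_option linter.dupNamespace false

open Set Filter Function TopologicalSpace Manifold Bundle
open scoped Topology Manifold ContDiff ENNReal NNReal

namespace Summit.FinalStateConjecture.FinalStateConjecture.Theorems.DarkFuture

open Literature.Geometry.Lorentzian
open Summit.FinalStateConjecture.FinalStateConjecture.Theorems.TameHull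

/-! ### §1 The exterior window: vacuity below `r₊ + η`, exact Kerr d.o.c.s, monotonicity -/

section Window

variable {𝓢 : Spacetime.{0} 4}

/-- **For `W ≤ r₊ + η` the exterior window `{r₊ + η < r < W, |t*| < W}` is empty.** [cite: DafermosLuk2017, §1.2.1] -/
theorem exteriorWindow_eq_empty {M a W η : ℝ} (h : W ≤ Kerr.rPlus M a + η) : exteriorWindow M a W η = ∅ :=
  eq_empty_of_forall_notMem fun _ hx ↦ by
    have h1 := hx.1
    have h2 := hx.2.1
    linarith

/-- **Small windows are vacuous.** If `W ≤ r₊ + η` then EVERY end of every spacetime is `(W, η, δ)`-window-close to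
Kerr `(M, a)` for every real `δ` (also `δ < 0`: the tolerance enters through `ENNReal.ofReal δ`): the window is empty, any
constant map is a chart of it, and the `C²` sup norm over the empty set is `0`. So the producer P′ must pick `W > r₊ + η`.
[cite: DafermosLuk2017, §1.2.1] -/
theorem isExteriorWindowClose_of_le (E : EndDatum 𝓢) {M a W η : ℝ} (h : W ≤ Kerr.rPlus M a + η) (δ : ℝ) :
    IsExteriorWindowClose 𝓢 E M a W η δ := by
  obtain ⟨q⟩ : Nonempty 𝓢.carrier := inferInstance
  refine ⟨fun _ ↦ q, ?_, ?_, ?_, ?_, ?_⟩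
  · rw [exteriorWindow_eq_empty h]; exact contMDiffOn_const
  · rw [exteriorWindow_eq_empty h]; exact injOn_empty _
  · rw [exteriorWindow_eq_empty h]; exact mapsTo_empty _ _
  · -- the `C²` sup norm over the empty set is `0`
    rw [exteriorWindow_eq_empty h, image_empty]
    simp [supCkENorm]
  · intro x hx
    rw [exteriorWindow_eq_empty h] at hx
    exact hx.elim

/-- **Exact Kerr d.o.c.s are window-close at every scale (anti-vacuity of P′'s hypothesis on the Kerr locus).** If the
d.o.c. of `E` is an exact Kerr `(M, a)` exterior (`IsKerrDoc 𝓢 E.doc M a`), then `E` contains an exterior window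
`(W, η, δ)`-close to Kerr `(M, a)` for ALL `W, η, δ`: the isometric chart of the d.o.c. restricted to the window
(deviation identically `0`). [cite: DafermosLuk2017, Conjecture 1] -/
theorem isExteriorWindowClose_of_isKerrDoc {E : EndDatum 𝓢} {M a : ℝ} (h : IsKerrDoc 𝓢 E.doc M a) (W η δ : ℝ) :
    IsExteriorWindowClose 𝓢 E M a W η δ := by
  obtain ⟨Ψ, hinj, hsmooth, hrange, hdev, hfut⟩ := h
  refine ⟨Ψ, hsmooth.contMDiffOn, hinj.injOn, fun x _ ↦ hrange ▸ mem_range_self x, ?_, fun x _ hx ↦ hfut x hx⟩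
  rw [deviationExtend_eq_zero hdev, supCkENorm_zero]
  exact zero_le

/-- The exterior window shrinks when `W` decreases and `η` increases. [cite: DafermosLuk2017, §1.2.1] -/
theorem exteriorWindow_mono {M a W W' η η' : ℝ} (hW : W' ≤ W) (hη : η ≤ η') :
    exteriorWindow M a W' η' ⊆ exteriorWindow M a W η :=
  fun _ hx ↦ ⟨by linarith [hx.1], by linarith [hx.2.1], by linarith [hx.2.2]⟩

/-- **Monotonicity of window closeness**: a `(W, η, δ)`-close window is `(W', η', δ')`-close for `W' ≤ W`, `η ≤ η'`,
`δ ≤ δ'` (same chart, smaller window, larger tolerance). [cite: DafermosLuk2017, §1.2.1] -/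
theorem _root_.Summit.FinalStateConjecture.FinalStateConjecture.Theorems.TameHull.IsExteriorWindowClose.mono {E : EndDatum 𝓢} {M a W η δ W' η' δ' : ℝ}
    (h : IsExteriorWindowClose 𝓢 E M a W η δ) (hW : W' ≤ W) (hη : η ≤ η') (hδ : δ ≤ δ') :
    IsExteriorWindowClose 𝓢 E M a W' η' δ' := by
  obtain ⟨Ψ, hsmooth, hinj, hmaps, hdev, hfut⟩ := h
  have hsub : exteriorWindow M a W' η' ⊆ exteriorWindow M a W η := exteriorWindow_mono hW hη
  exact ⟨Ψ, hsmooth.mono hsub, hinj.mono hsub, hmaps.mono_left hsub,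
    (supCkENorm_mono (image_mono hsub) _ _).trans (hdev.trans (ENNReal.ofReal_le_ofReal hδ)),
    fun x hx hr ↦ hfut x (hsub hx) hr⟩

end Window

/-! ### §2 Trimming: horizon-hull membership passes to connected open sub-spacetimes (no covering clause) -/

section Trim

variable {X : Type} [TopologicalSpace X] [ChartedSpace E3 X] [IsManifold (𝓡 3) ∞ X]
  [ConnectedSpace X] {D : InitialDataSet (𝓡 3) X}

/-- **Trimming a horizon-hull element along `s`.** Let `(𝓢, E, p)` be a horizon-hull element of `𝒟` along `γ ∘ s`
and let `W ∋ p` be a connected open subset of `𝓢`. If the open sub-spacetime `𝓢|_W` carries an end datum `E'` which is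
in a class `(Λ', r₀')`, silent, with `p` on its horizon (the TRANSPORTED end: same far chart, clock, d.o.c., horizon and
tame balls — available as soon as `W` contains `closure E.doc ∪ range E.far` and the images of the tame balls, e.g.
`W = 𝓢 ∖ (a closed piece of the deep collar)`), then `(𝓢|_W, E', p)` is a horizon-hull element of `𝒟` along THE SAME
`γ ∘ s`: the pointed `C²_loc` subconvergence `(𝒟, γ sₙ) ⇀ (𝓢, p)` passes to `(𝓢|_W, p)` because the tree's notion has
no covering clause (`SubconvergesLocallyTo.restrict'`). Hull provenance pins nothing outside what the end structure
touches. [cite: Petersen2006, Ch. 10 §3.2] -/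
theorem _root_.Summit.FinalStateConjecture.FinalStateConjecture.Theorems.TameHull.IsHorizonHullElementAlong.trim
    {𝒟 : VacuumCauchyDevelopment D} [𝒟.metric.HasLeviCivita]
    {Λ Λ' : ℕ → ℝ≥0} {r₀ r₀' : ℝ} {γ : ℝ → 𝒟.carrier} {s : ℕ → ℝ} {𝓢 : Spacetime.{0} 4} {E : EndDatum 𝓢}
    {p : 𝓢.carrier} (h : IsHorizonHullElementAlong 𝒟 Λ r₀ γ s 𝓢 E p) (W : Opens 𝓢.carrier)
    (hW : IsConnected (W : Set 𝓢.carrier)) (hp : p ∈ W)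
    (E' : EndDatum (𝓢.restrict PseudoRiemannianMetric.contMDiff_restrict_holds
      𝓢.timeOrientation.contMDiff_restrict_holds W hW))
    (hcls : IsTameClass E' Λ' r₀') (hsil : E'.IsSilent) (hhor : Subtype.mk p hp ∈ E'.horizon) :
    IsHorizonHullElementAlong 𝒟 Λ' r₀' γ s
      (𝓢.restrict PseudoRiemannianMetric.contMDiff_restrict_holds 𝓢.timeOrientation.contMDiff_restrict_holds W hW)
      E' (Subtype.mk p hp) :=
  ⟨hcls, hsil, hhor, h.2.2.2.restrict' W hW hp⟩

/-- **Trimming a horizon-hull element along `γ`** (member of the based hull `Ω_γ`): same statement with the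
subsequence `sₙ → +∞` existential — the trimmed sibling lies in `Ω_γ` along the same `sₙ`. [cite: Petersen2006, Ch. 10 §3.2] -/
theorem _root_.Summit.FinalStateConjecture.FinalStateConjecture.Theorems.TameHull.IsHorizonHullElement.trim
    {𝒟 : VacuumCauchyDevelopment D} [𝒟.metric.HasLeviCivita]
    {Λ Λ' : ℕ → ℝ≥0} {r₀ r₀' : ℝ} {γ : ℝ → 𝒟.carrier} {𝓢 : Spacetime.{0} 4} {E : EndDatum 𝓢}
    {p : 𝓢.carrier} (h : IsHorizonHullElement 𝒟 Λ r₀ γ 𝓢 E p) (W : Opens 𝓢.carrier)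
    (hW : IsConnected (W : Set 𝓢.carrier)) (hp : p ∈ W)
    (E' : EndDatum (𝓢.restrict PseudoRiemannianMetric.contMDiff_restrict_holds
      𝓢.timeOrientation.contMDiff_restrict_holds W hW))
    (hcls : IsTameClass E' Λ' r₀') (hsil : E'.IsSilent) (hhor : Subtype.mk p hp ∈ E'.horizon) :
    IsHorizonHullElement 𝒟 Λ' r₀' γ
      (𝓢.restrict PseudoRiemannianMetric.contMDiff_restrict_holds 𝓢.timeOrientation.contMDiff_restrict_holds W hW)
      E' (Subtype.mk p hp) := by
  obtain ⟨s, hs, hZ⟩ := h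
  exact ⟨s, hs, hZ.trim W hW hp E' hcls hsil hhor⟩

end Trim

/-! ### §3 Re-choosing the end structure (in particular the CLOCK) on the same carrier keeps hull membership -/

section Reclock

variable {𝓢 : Spacetime.{0} 4}

/-- Re-clocking an end datum (same reference mass, far cylinder, far chart; new clock) does not change its domain of
outer communications `I⁺(far) ∩ I⁻(far)` — definitionally. [cite: Wald1984, §12.1] -/
theorem doc_reclock (E : EndDatum 𝓢) (clock' : 𝓢.carrier → ℝ) :
    (⟨E.M, E.R, E.C, E.far, clock'⟩ : EndDatum 𝓢).doc = E.doc := rfl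

/-- Re-clocking does not change the future event horizon `∂I⁻(far) ∩ I⁺(far)` of the end. [cite: Wald1984, §12.1] -/
theorem horizon_reclock (E : EndDatum 𝓢) (clock' : 𝓢.carrier → ℝ) :
    (⟨E.M, E.R, E.C, E.far, clock'⟩ : EndDatum 𝓢).horizon = E.horizon := rfl

/-- Re-clocking does not change the far deviation `h = far^* g − g_{M,0}`. [folklore] -/
theorem h_reclock (E : EndDatum 𝓢) (clock' : 𝓢.carrier → ℝ) :
    (⟨E.M, E.R, E.C, E.far, clock'⟩ : EndDatum 𝓢).h = E.h := rfl

/-- Re-clocking does not change two-sided non-radiation (a property of the far chart alone). [cite: AlexakisSchlue2018, Thm. 1.1] -/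
theorem isNonRadiating_reclock_iff (E : EndDatum 𝓢) (clock' : 𝓢.carrier → ℝ) :
    (⟨E.M, E.R, E.C, E.far, clock'⟩ : EndDatum 𝓢).IsNonRadiating ↔ E.IsNonRadiating := Iff.rfl

/-- Re-clocking does not change exterior-window closeness (the window is mapped into the d.o.c., which is clock-free).
[cite: DafermosLuk2017, §1.2.1] -/
theorem isExteriorWindowClose_reclock_iff (E : EndDatum 𝓢) (clock' : 𝓢.carrier → ℝ) (M a W η δ : ℝ) :
    IsExteriorWindowClose 𝓢 ⟨E.M, E.R, E.C, E.far, clock'⟩ M a W η δ ↔ IsExteriorWindowClose 𝓢 E M a W η δ :=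
  Iff.rfl

/-- Re-clocking does not change "the d.o.c. is an exact Kerr `(M, a)` exterior". [cite: DafermosLuk2017, Conjecture 1] -/
theorem isKerrDoc_doc_reclock_iff (E : EndDatum 𝓢) (clock' : 𝓢.carrier → ℝ) (M a : ℝ) :
    IsKerrDoc 𝓢 (⟨E.M, E.R, E.C, E.far, clock'⟩ : EndDatum 𝓢).doc M a ↔ IsKerrDoc 𝓢 E.doc M a := Iff.rfl

variable {X : Type} [TopologicalSpace X] [ChartedSpace E3 X] [IsManifold (𝓡 3) ∞ X]
  [ConnectedSpace X] {D : InitialDataSet (𝓡 3) X}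

/-- **Hull membership is a property of the pointed carrier.** If `(𝓢, E, p)` is a horizon-hull element of `𝒟` along
`γ ∘ s` and `E'` is ANY end datum of the same spacetime `𝓢` which lies in some class `(Λ', r₀')`, is silent and has `p`
on its horizon, then `(𝓢, E', p)` is a horizon-hull element of `𝒟` along the same `γ ∘ s`, in the class `(Λ', r₀')`:
the subconvergence clause of `IsHorizonHullElementAlong` does not mention the end datum. In particular every admissible
RE-CLOCKING `⟨E.M, E.R, E.C, E.far, clock'⟩` of a hull element is a hull element (its d.o.c., horizon, non-radiation and
windows are those of `E`, `doc_reclock` … `isExteriorWindowClose_reclock_iff`); the producer P′ must serve all of them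
with ONE window size and conclude slab-closeness in EACH one's own clock. [cite: Anderson2004, Def. 1.1] -/
theorem _root_.Summit.FinalStateConjecture.FinalStateConjecture.Theorems.TameHull.IsHorizonHullElementAlong.of_sameCarrier
    {𝒟 : VacuumCauchyDevelopment D} [𝒟.metric.HasLeviCivita]
    {Λ Λ' : ℕ → ℝ≥0} {r₀ r₀' : ℝ} {γ : ℝ → 𝒟.carrier} {s : ℕ → ℝ} {𝓢 : Spacetime.{0} 4} {E : EndDatum 𝓢}
    {p : 𝓢.carrier} (h : IsHorizonHullElementAlong 𝒟 Λ r₀ γ s 𝓢 E p) (E' : EndDatum 𝓢)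
    (hcls : IsTameClass E' Λ' r₀') (hsil : E'.IsSilent) (hhor : p ∈ E'.horizon) :
    IsHorizonHullElementAlong 𝒟 Λ' r₀' γ s 𝓢 E' p :=
  ⟨hcls, hsil, hhor, h.2.2.2⟩

/-- **Hull membership along `γ` is a property of the pointed carrier** (`sₙ → +∞` threaded). [cite: Anderson2004, Def. 1.1] -/
theorem _root_.Summit.FinalStateConjecture.FinalStateConjecture.Theorems.TameHull.IsHorizonHullElement.of_sameCarrier
    {𝒟 : VacuumCauchyDevelopment D} [𝒟.metric.HasLeviCivita]
    {Λ Λ' : ℕ → ℝ≥0} {r₀ r₀' : ℝ} {γ : ℝ → 𝒟.carrier} {𝓢 : Spacetime.{0} 4} {E : EndDatum 𝓢}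
    {p : 𝓢.carrier} (h : IsHorizonHullElement 𝒟 Λ r₀ γ 𝓢 E p) (E' : EndDatum 𝓢)
    (hcls : IsTameClass E' Λ' r₀') (hsil : E'.IsSilent) (hhor : p ∈ E'.horizon) :
    IsHorizonHullElement 𝒟 Λ' r₀' γ 𝓢 E' p := by
  obtain ⟨s, hs, hZ⟩ := h
  exact ⟨s, hs, hZ.of_sameCarrier E' hcls hsil hhor⟩

/-- **Re-clocked hull elements**: the special case `E' = ⟨E.M, E.R, E.C, E.far, clock'⟩` — the horizon clause is
inherited (`horizon_reclock`), so only the class and silence of the new clock are to be checked. [cite: Anderson2004, Def. 1.1] -/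
theorem _root_.Summit.FinalStateConjecture.FinalStateConjecture.Theorems.TameHull.IsHorizonHullElement.reclock
    {𝒟 : VacuumCauchyDevelopment D} [𝒟.metric.HasLeviCivita]
    {Λ Λ' : ℕ → ℝ≥0} {r₀ r₀' : ℝ} {γ : ℝ → 𝒟.carrier} {𝓢 : Spacetime.{0} 4} {E : EndDatum 𝓢}
    {p : 𝓢.carrier} (h : IsHorizonHullElement 𝒟 Λ r₀ γ 𝓢 E p) (clock' : 𝓢.carrier → ℝ)
    (hcls : IsTameClass (⟨E.M, E.R, E.C, E.far, clock'⟩ : EndDatum 𝓢) Λ' r₀')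
    (hsil : (⟨E.M, E.R, E.C, E.far, clock'⟩ : EndDatum 𝓢).IsSilent) :
    IsHorizonHullElement 𝒟 Λ' r₀' γ 𝓢 ⟨E.M, E.R, E.C, E.far, clock'⟩ p := by
  refine h.of_sameCarrier _ hcls hsil ?_
  obtain ⟨s, _hs, _hcls, _hsil, hp, _hsub⟩ := h
  exact hp

end Reclock

/-! ### §4 The registered statement P′ is refuted by a witness defeating every depth (negated formula = P′ verbatim) -/

section Negative

variable {X : Type} [TopologicalSpace X] [ChartedSpace E3 X] [IsManifold (𝓡 3) ∞ X]
  [T2Space X] [SecondCountableTopology X] [ConnectedSpace X] {D : InitialDataSet (𝓡 3) X}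

/-- **A depth-uniform witness refutes P′ (`HullNearKerrIsSlabClose` after Reshape 1, inlined verbatim as the negated
statement).** Suppose some development `𝒟` as in Φ (`DevHyp`), class `(Λ, r₀)`, horizon generator path `γ` and
sub-extremal `(M, a)` admit, for EVERY depth `ρ ∈ (r₋, r₊)`, an order `k`, a weight `β < 2` and a tolerance `ε > 0` such
that for EVERY window size `(W, η, δ)` (`0 < η`, `0 < δ`) some horizon-hull element along `γ` IS `(W, η, δ)`-window-close to
Kerr `(M, a)` but is `ε`-slab-close from depth `ρ` (order `k`, weight `β`) to NO Kerr `(M', a')` with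
`|M' − M| + |a' − a| ≤ ε` at any clock epoch `c`. Then P′ is false. Intended witnesses (paper-level, both conditional only on
the line's non-vacuity): ONE element with exact-Kerr d.o.c. RE-CLOCKED by a stationary radial clock of drift `> 2`
(§3: the unit clock-epoch then spans Kerr–Schild time `> 4`, so the coverage clause of `IsSlabClose` fails for every
`ε`-isometric slab of `x⁰`-width `4`, every `ρ`, every `c`), or TRIMMED below the reach of its tame balls (§2).
[cite: DafermosLuk2017, §1.2.1] -/
theorem not_hullNearKerrIsSlabClose_of_witness (hD : D ∈ admissibleVacuumData X)
    (𝒟 : VacuumCauchyDevelopment D) [𝒟.metric.HasLeviCivita] (hdev : DevHyp 𝒟) {Λ : ℕ → ℝ≥0} {r₀ : ℝ}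
    {γ : ℝ → 𝒟.carrier} (hγ : IsHorizonPath 𝒟 γ) {M a : ℝ} (hM : 0 < M) (ha : |a| < M)
    (hwit : ∀ ρ : ℝ, Kerr.rMinus M a < ρ → ρ < Kerr.rPlus M a → ∃ (k : ℕ) (β : ℝ), β < 2 ∧ ∃ ε > (0 : ℝ),
      ∀ W η δ : ℝ, 0 < η → 0 < δ →
        ∃ (𝓢 : Spacetime.{0} 4) (E : EndDatum 𝓢) (p : 𝓢.carrier),
          IsHorizonHullElement 𝒟 Λ r₀ γ 𝓢 E p ∧ IsExteriorWindowClose 𝓢 E M a W η δ ∧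
            ∀ M' a' c : ℝ, |M' - M| + |a' - a| ≤ ε → ¬ IsSlabClose 𝓢 E M' a' ρ k β c ε) :
    ¬ ∀ (X : Type) [TopologicalSpace X] [ChartedSpace E3 X] [IsManifold (𝓡 3) ∞ X] [T2Space X]
      [SecondCountableTopology X] [ConnectedSpace X], ∀ D ∈ admissibleVacuumData X,
      ∀ (𝒟 : VacuumCauchyDevelopment D) [𝒟.metric.HasLeviCivita], DevHyp 𝒟 →
        ∀ (Λ : ℕ → ℝ≥0) (r₀ : ℝ) (γ : ℝ → 𝒟.carrier), IsHorizonPath 𝒟 γ →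
          ∀ M a : ℝ, 0 < M → |a| < M → ∃ ρ : ℝ, Kerr.rMinus M a < ρ ∧ ρ < Kerr.rPlus M a ∧
            ∀ (k : ℕ) (β : ℝ), β < 2 → ∀ ε > (0 : ℝ),
            ∃ W η δ : ℝ, 0 < η ∧ 0 < δ ∧
              ∀ (𝓢 : Spacetime.{0} 4) (E : EndDatum 𝓢) (p : 𝓢.carrier),
                IsHorizonHullElement 𝒟 Λ r₀ γ 𝓢 E p → IsExteriorWindowClose 𝓢 E M a W η δ →
                  ∃ M' a' c : ℝ, |M' - M| + |a' - a| ≤ ε ∧ IsSlabClose 𝓢 E M' a' ρ k β c ε := by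
  intro hP
  obtain ⟨ρ, hρ₁, hρ₂, h⟩ := hP X D hD 𝒟 hdev Λ r₀ γ hγ M a hM ha
  obtain ⟨k, β, hβ, ε, hε, hw⟩ := hwit ρ hρ₁ hρ₂
  obtain ⟨W, η, δ, hη, hδ, h'⟩ := h k β hβ ε hε
  obtain ⟨𝓢, E, p, hZ, hwin, hno⟩ := hw W η δ hη hδ
  obtain ⟨M', a', c, hnear, hslab⟩ := h' 𝓢 E p hZ hwin
  exact hno M' a' c hnear hslab

omit [T2Space X] [SecondCountableTopology X] in
/-- **The witness, assembled on ONE carrier.** If along `γ` there is a horizon-hull element `(𝓢, E, p)` (class `(Λ, r₀)`),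
and for every depth `ρ ∈ (r₋, r₊)` an end datum `E_ρ` OF THE SAME `𝓢` (e.g. a re-clocking of `E`, §3) in the class, silent,
with `p` on its horizon, which is window-close to Kerr `(M, a)` at EVERY scale (e.g. because its d.o.c. is an exact Kerr
`(M, a)` exterior, `isExteriorWindowClose_of_isKerrDoc`) but for some `(k, β < 2, ε > 0)` admits no `ε`-slab chart from
depth `ρ` to any `ε`-near Kerr at any epoch, then the hypothesis of `not_hullNearKerrIsSlabClose_of_witness` holds
(`IsHorizonHullElement.of_sameCarrier`). [cite: Anderson2004, Def. 1.1] -/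
theorem witness_of_sameCarrier {𝒟 : VacuumCauchyDevelopment D} [𝒟.metric.HasLeviCivita] {Λ : ℕ → ℝ≥0}
    {r₀ : ℝ} {γ : ℝ → 𝒟.carrier} {M a : ℝ} {𝓢 : Spacetime.{0} 4} {E : EndDatum 𝓢} {p : 𝓢.carrier}
    (hZ : IsHorizonHullElement 𝒟 Λ r₀ γ 𝓢 E p)
    (hsib : ∀ ρ : ℝ, Kerr.rMinus M a < ρ → ρ < Kerr.rPlus M a →
      ∃ E' : EndDatum 𝓢, IsTameClass E' Λ r₀ ∧ E'.IsSilent ∧ p ∈ E'.horizon ∧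
        (∀ W η δ : ℝ, IsExteriorWindowClose 𝓢 E' M a W η δ) ∧
        ∃ (k : ℕ) (β : ℝ), β < 2 ∧ ∃ ε > (0 : ℝ),
          ∀ M' a' c : ℝ, |M' - M| + |a' - a| ≤ ε → ¬ IsSlabClose 𝓢 E' M' a' ρ k β c ε) :
    ∀ ρ : ℝ, Kerr.rMinus M a < ρ → ρ < Kerr.rPlus M a → ∃ (k : ℕ) (β : ℝ), β < 2 ∧ ∃ ε > (0 : ℝ),
      ∀ W η δ : ℝ, 0 < η → 0 < δ →
        ∃ (𝓢' : Spacetime.{0} 4) (E' : EndDatum 𝓢') (p' : 𝓢'.carrier),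
          IsHorizonHullElement 𝒟 Λ r₀ γ 𝓢' E' p' ∧ IsExteriorWindowClose 𝓢' E' M a W η δ ∧
            ∀ M' a' c : ℝ, |M' - M| + |a' - a| ≤ ε → ¬ IsSlabClose 𝓢' E' M' a' ρ k β c ε := by
  intro ρ hρ₁ hρ₂
  obtain ⟨E', hcls, hsil, hhor, hwin, k, β, hβ, ε, hε, hno⟩ := hsib ρ hρ₁ hρ₂
  exact ⟨k, β, hβ, ε, hε, fun W η δ _ _ ↦ ⟨𝓢, E', p, hZ.of_sameCarrier E' hcls hsil hhor, hwin W η δ, hno⟩⟩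

end Negative

/-! ### §5 The registered bundle (sub-goal `stub_hullNearKerrIsSlabClose_closedPieces` of stmt-FinalStateConjecture-17430) -/

/-- **Closed pieces of stub P′ `stub_hullNearKerrIsSlabClose`** (registered sub-goal, one-line signature): (i) small windows
are vacuous; (ii) exact Kerr d.o.c.s are window-close at every scale; (iii) window closeness is monotone; (iv) hull membership
along `γ` is a property of the pointed carrier (any admissible end datum of the same spacetime — in particular any
re-clocking — gives a hull element along the same `γ`); (v) a depth-uniform witness refutes the registered P′.
[cite: DafermosLuk2017, §1.2.1] -/
theorem stub_hullNearKerrIsSlabClose_closedPieces : (∀ {𝓢 : Spacetime.{0} 4} (E : EndDatum 𝓢) {M a W η : ℝ}, W ≤ Kerr.rPlus M a + η → ∀ δ : ℝ, IsExteriorWindowClose 𝓢 E M a W η δ) ∧ (∀ {𝓢 : Spacetime.{0} 4} {E : EndDatum 𝓢} {M a : ℝ}, IsKerrDoc 𝓢 E.doc M a → ∀ W η δ : ℝ, IsExteriorWindowClose 𝓢 E M a W η δ) ∧ (∀ {𝓢 : Spacetime.{0} 4} {E : EndDatum 𝓢} {M a W η δ W' η' δ' : ℝ}, IsExteriorWindowClose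 𝓢 E M a W η δ → W' ≤ W → η ≤ η' → δ ≤ δ' → IsExteriorWindowClose 𝓢 E M a W' η' δ') ∧ (∀ {X : Type} [TopologicalSpace X] [ChartedSpace E3 X] [IsManifold (𝓡 3) ∞ X] [ConnectedSpace X] {D : InitialDataSet (𝓡 3) X} (𝒟 : VacuumCauchyDevelopment D) [𝒟.metric.HasLeviCivita] {Λ Λ' : ℕ → ℝ≥0} {r₀ r₀' : ℝ} {γ : ℝ → 𝒟.carrier} {𝓢 : Spacetime.{0} 4} {E : EndDatum 𝓢} {p : 𝓢.carrier}, IsHorizonHullElement 𝒟 Λ r₀ γ 𝓢 E p → ∀ E' : EndDatum 𝓢, IsTameClass E' Λ' r₀' → E'.IsSilent → p ∈ E'.horizon → IsHorizonHullElement 𝒟 Λ' r₀' γ 𝓢 E' p) ∧ ∀ {X : Type} [TopologicalSpace X] [ChartedSpace E3 X] [IsManifold (𝓡 3) ∞ X] [T2Space X] [SecondCountableTopology X] [ConnectedSpace X] {D : InitialDataSet (𝓡 3) X}, D ∈ admissibleVacuumData X → ∀ (𝒟 : VacuumCauchyDevelopment D) [𝒟.metric.HasLeviCivita], DevHyp 𝒟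 → ∀ {Λ : ℕ → ℝ≥0} {r₀ : ℝ} {γ : ℝ → 𝒟.carrier}, IsHorizonPath 𝒟 γ → ∀ {M a : ℝ}, 0 < M → |a| < M → (∀ ρ : ℝ, Kerr.rMinus M a < ρ → ρ < Kerr.rPlus M a → ∃ (k : ℕ) (β : ℝ), β < 2 ∧ ∃ ε > (0 : ℝ), ∀ W η δ : ℝ, 0 < η → 0 < δ → ∃ (𝓢 : Spacetime.{0} 4) (E : EndDatum 𝓢) (p : 𝓢.carrier), IsHorizonHullElement 𝒟 Λ r₀ γ 𝓢 E p ∧ IsExteriorWindowClose 𝓢 E M a W η δ ∧ ∀ M' a' c : ℝ, |M' - M| + |a' - a| ≤ ε → ¬ IsSlabClose 𝓢 E M' a' ρ k β c ε) → ¬ ∀ (X : Type) [TopologicalSpace X] [ChartedSpace E3 X] [IsManifold (𝓡 3) ∞ X] [T2Space X] [SecondCountableTopology X] [ConnectedSpace X], ∀ D ∈ admissibleVacuumData X, ∀ (𝒟 : VacuumCauchyDevelopment D) [𝒟.metric.HasLeviCivita], DevHyp 𝒟 → ∀ (Λ : ℕ → ℝ≥0) (r₀ : ℝ) (γ : ℝ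 → 𝒟.carrier), IsHorizonPath 𝒟 γ → ∀ M a : ℝ, 0 < M → |a| < M → ∃ ρ : ℝ, Kerr.rMinus M a < ρ ∧ ρ < Kerr.rPlus M a ∧ ∀ (k : ℕ) (β : ℝ), β < 2 → ∀ ε > (0 : ℝ), ∃ W η δ : ℝ, 0 < η ∧ 0 < δ ∧ ∀ (𝓢 : Spacetime.{0} 4) (E : EndDatum 𝓢) (p : 𝓢.carrier), IsHorizonHullElement 𝒟 Λ r₀ γ 𝓢 E p → IsExteriorWindowClose 𝓢 E M a W η δ → ∃ M' a' c : ℝ, |M' - M| + |a' - a| ≤ ε ∧ IsSlabClose 𝓢 E M' a' ρ k β c ε :=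
  by
  refine ⟨?_, ?_, ?_, ?_, ?_⟩
  · intro 𝓢 E M a W η h δ
    exact isExteriorWindowClose_of_le E h δ
  · intro 𝓢 E M a h W η δ
    exact isExteriorWindowClose_of_isKerrDoc h W η δ
  · intro 𝓢 E M a W η δ W' η' δ' h hW hη hδ
    exact h.mono hW hη hδ
  · intro X _ _ _ _ D 𝒟 _ Λ Λ' r₀ r₀' γ 𝓢 E p h E' hcls hsil hhor
    exact h.of_sameCarrier E' hcls hsil hhor
  · intro X _ _ _ _ _ _ D hD 𝒟 _ hdev Λ r₀ γ hγ M a hM ha hwit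
    exact not_hullNearKerrIsSlabClose_of_witness hD 𝒟 hdev hγ hM ha hwit

end Summit.FinalStateConjecture.FinalStateConjecture.Theorems.DarkFuture

end
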